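import Summits.NavierStokesRegularity.NavierStokesRegularity.Theses.ComplexTouchdown
import HarnessLib.Audit

/-!
# Birth skeleton (BC3) of the crux `ComplexTouchdown.NoSheetTouchdown`

(crux item `stmt-NavierStokesRegularity-13850`, rank 3, route
`route-NavierStokesRegularity-ComplexTouchdown`; tree path `Cruxes/NoSheetTouchdown/Lines/birth.lean`;
registrar `planner-skel-stmt-NavierStokesRegularity-13850-0`, 2026-08-17. The route predates the Lean birth
certificate; this file supplies BC3 retroactively. `ledger crux ls`: no workfiles before this one, in
particular no `Disproof.lean`, so there is no `_false_without_` obstruction to honour.)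

THE CRUX. For a classical solution `(u,p)` of unforced NS on `ℝ³ × [0,T)` which is Leray–Hopf from the
rapidly decaying datum `u 0`, NO point `x₀` carries a conjugate-pair SHEET touchdown: data
`(r,c,K,α,τ,B,Φ,h,m,F)` — a holomorphic, bounded (`K`), uniformly non-characteristic (`c`) defining
function `Φ_t` on the complex ball `B(ιx₀,r)`, zero-free on the two-sided tube `D_t` of half-width
`h(t) → 0` over `B(x₀,r)` but with a roof zero above a point of `B(x₀,r/2)`, and the continuation `F_t`
of `u(t)` to `D_t` obeying the pair-of-poles upper bound `‖F_t‖ ≤ K m(t)(|Φ_t|^{-α} + |Φ_t∘σ|^{-α}) + B`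
on the collar and the pole lower bound `c m(t)|Φ_t|^{-α} - B ≤ ‖F_t‖` on `{|Φ_t| < c h(t)} ∩ D_t`,
`α ≥ 2` (the negand is byte-identical to the SHEET disjunct of `TouchdownDichotomy`).

THE CUT = the route's own expected mechanism ("Leray rate × footprint dissipation against the energy
budget", route header #3 and the item's informal text), with its two NS-theoretic inputs and its two
complex→real transfers NAMED SEPARATELY:

* `stub_sheetPointIsSingular` [M/L; several complex variables + local analyticity radius]: SHEET data at
  `x₀` force `x₀` to be an `L∞`-singular point of `u` at time `T` (the touchdown predicate of the route's
  target `NoTouchdown`). Mechanism: `F_t → ∞` at the roof zero `z*(t)` (lower bound on the scale-aware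
  collar, `|Φ_t| → 0` there), while a solution bounded on a backward neighbourhood of `(x₀,T)` has, by
  the local analyticity radius (`Literature.Analysis.FluidPDE.bradshawGrujicKukavica2015_local_analyticity_radius`,
  BGK 2016 Thm 2.3.1) and the identity theorem on the totally real slice, a continuation holomorphic AT
  `z*(t)` once `h(t)` drops below the radius — contradiction (the fact is PROVED in tree:
  `bradshawGrujicKukavica2015_local_analyticity_radius_holds`). Why it might fail: only through the local
  `L^{q/2}` pressure hypothesis of BGK (needs the pressure representation `p = R_iR_j(u_iu_j)` for
  Leray–Hopf solutions from decaying data, locally in `L^∞_t L^{q/2}_x`) and the SCV identity theorem on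
  the tube (Mathlib has the one-variable identity theorem; the slice-wise reduction is routine).
* `stub_localLerayRate` [L/XL, OPEN in general; NS regularity theory, no complex analysis]: at an
  `L∞`-singular point `x₀` the LOCAL supremum obeys Leray's rate: for every `r' > 0` there are `c₁ > 0`,
  `t₁ < T` with `sup_{B(x₀,r')} |u(t)|² ≥ c₁/(T-t)` for all `t ∈ [t₁,T)`. Known globally
  (`Literature.Analysis.FluidPDE.leray_blowup_rate_top`, `_holds` proved; Leray 1934 §20) and, at the
  similarity scale, locally under a Type-I Morrey bound (`Literature.Analysis.FluidPDE.BarkerPrange2020_thm2`,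
  `_holds` proved; arXiv:1812.09115 Thm 2); without Type I only the fixed-ball `L³` concentration
  `‖u(t)‖_{L³(B₁(x₀))} > γ_univ` on `[t_*,T*)` is printed (BarkerPrange2020, arXiv p.5, "Final
  discussion"), which gives a constant lower bound for the local sup, not a rate. The item's informal text
  flags exactly this input ("a LOCAL version at x₀ is needed"). Why it might fail: a singularity fed from
  outside `B(x₀,r')` whose local maximum lags behind Leray's rate on a sequence of times; localized
  smoothing from bounded data on `B(x₀,2r')` (Jia–Šverák 2014 / Barker–Prange Thm 1 type) gives SOME local
  rate with energy-dependent constants, but — as far as searched — not the exponent `1/2` for all `t`.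
* `stub_sheetCarriesLocalMax` [XL, OPEN; the first complex→real transfer]: near `x₀` and for `t` close to
  `T` the real trace is dominated by the pole pair: `|u(t,x)|² ≤ C m(t)² h(t)^{-2α} + B'` on a ball
  `B(x₀,r₂)`. On the collar `{|Φ_t(ιx)| < c}` this is the SHEET upper bound at real points (where
  `σ(ιx) = ιx`, so the two poles coincide) together with `|Φ_t(ιx)| ≳ √c · h(t)` (zero-freeness of `D_t`
  + non-characteristic gradient); OFF the collar SHEET asserts nothing, and the stub claims that no
  second, point-like concentration coexists with the sheet inside `B(x₀,r₂)`. Why it might fail: exactly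
  such a coexisting off-collar concentration (the SHEET predicate does not exclude it).
* `stub_footprintDissipation` [XL, OPEN; the second complex→real transfer, the route's "D(t) ≍ ν‖u‖²/κ"]:
  the local dissipation dominates the squared pole amplitude: `ofReal (c₂ m(t)² h(t)^{-2α}) ≤
  ∫⁻_{B(x₀,r)} |∇u(t)|² + ofReal B₂` for `t` close to `T`. Mechanism: in units of `h(t)` around the foot
  point the rescaled continuations form a normal family on the slab (bounded on the rescaled collar,
  which exhausts every compact of the open slab), the pole lower bound survives in the limit, so the real
  trace cannot degenerate: `∫_{B(x*,h)} |∇u|² ≳ θ m² h^{1-2α}`; the missing factor `h^{-1}` must come from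
  the tangential extent `≳ √(h/κ)` of the footprint (`κ ≤ κ_max(K,c,r)` by Cauchy bounds on `Φ_t`). Why
  it might fail: the damping example `a(2/(1+w²))^α e^{-M(1+w²)}` shows the trace/pole ratio is only
  controlled up to `c,K`-dependent constants, and the footprint-area step is unwritten.
* `stub_energyBudget` [M; Leray–Hopf energy inequality]: `∫₀ᵀ ∫ |∇u|² < ∞` with the CLASSICAL gradient
  `fderiv ℝ (u t)`: the weak gradient `G` of `IsLerayHopfOn.weakGrad_energy` agrees a.e. with the
  classical one (`HasWeakGradient.of_contDiff` + uniqueness of weak gradients). Why it might fail: only a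
  typing slip (it is the energy inequality).

GLUE (real, closed, ≈ 70 lines, `NoSheetTouchdown_of_hyps`, concluding the crux body verbatim): given SHEET data at `x₀`, stub 1 makes
`x₀` singular; stubs 2+3 give `c₁/(T-t) ≤ |u(t,x_t)|² ≤ C m²h^{-2α} + B'` at some `x_t ∈ B(x₀,r₂)`, hence
`ofReal (a/(T-t)) ≤ ofReal (c₂ m²h^{-2α}) + ofReal (c₂B'/C)`, `a = c₂c₁/C > 0`; stub 4 bounds the middle
term by the local dissipation `+ ofReal B₂`; integrating over `(t₃,T)` the left side is `∞`
(`lintegral_ofReal_div_sub_eq_top`, the harmonic divergence `∫ dt/(T-t) = ∞`, proved here from Mathlib's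
`intervalIntegrable_sub_inv_iff`) while the right side is at most the energy budget of stub 5 plus a
constant times `T - t₃` — contradiction. `NoSheetTouchdown_of : Theses.ComplexTouchdown.NoSheetTouchdown`
is the skeleton theorem (crux BY NAME, the five stubs used by name).

BC3 PROBES (`bc/probe_stub_*.lean`, quoted in `Lines/birth.md`): for each stub `S`, `S → NoSheetTouchdown`
and `S → NavierStokesRegularity` by `first | exact? | simpa | aesop` FAIL.
-/

noncomputable section

open Set MeasureTheory Filter Topology
open scoped ENNReal

namespace Summit.NavierStokesRegularity.NavierStokesRegularity.Cruxes.NoSheetTouchdown.Birth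

set_option linter.unusedVariables false
set_option linter.dupNamespace false
set_option linter.style.longLine false

/-- **stub 1 — `stub_sheetPointIsSingular` (M/L; SCV + local analyticity radius).** Conjugate-pair
SHEET data at `x₀` (the crux's negand, verbatim) force `x₀` to be an `L∞`-singular point of `u` at
time `T`: `u` is unbounded on every backward neighbourhood `(T-r',T) × B(x₀,r')`. -/
theorem stub_sheetPointIsSingular :
    ∀ (ι : EuclideanSpace ℝ (Fin 3) → EuclideanSpace ℂ (Fin 3)),
      (∀ x : EuclideanSpace ℝ (Fin 3), ι x = Literature.Analysis.FunctionSpaces.EuclideanSpace.complexify x) →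
      ∀ (ν T : ℝ) (u : ℝ → EuclideanSpace ℝ (Fin 3) → EuclideanSpace ℝ (Fin 3)) (p : ℝ → EuclideanSpace ℝ (Fin 3) → ℝ), 0 < ν → 0 < T →
      Literature.Analysis.FluidPDE.IsClassicalNSSolutionOn (Set.Ico 0 T) ν 0 u p →
      Literature.Analysis.FluidPDE.IsLerayHopfOn T ν 0 (u 0) u →
      Literature.Analysis.FluidPDE.HasRapidSpatialDecay (u 0) →
      ∀ x₀ : EuclideanSpace ℝ (Fin 3),
      ∀ (r c K α τ B : ℝ) (Φ : ℝ → EuclideanSpace ℂ (Fin 3) → ℂ) (h m : ℝ → ℝ) (F : ℝ → EuclideanSpace ℂ (Fin 3) → EuclideanSpace ℂ (Fin 3)),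
      (0 < r ∧ 0 < c ∧ 2 ≤ α ∧ 0 < τ ∧ τ ≤ T ∧ Filter.Tendsto h (nhdsWithin T (Set.Iio T)) (nhds 0) ∧ ∀ t ∈ Set.Ico (T - τ) T, ∀ (D : Set (EuclideanSpace ℂ (Fin 3))), D = (Metric.ball (ι x₀) r ∩ {z : EuclideanSpace ℂ (Fin 3) | ∃ x y : EuclideanSpace ℝ (Fin 3), dist x x₀ < r ∧ ‖y‖ < h t ∧ z = ι x + Complex.I • ι y}) → 0 < h t ∧ 0 < m t ∧ DifferentiableOn ℂ (Φ t) (Metric.ball (ι x₀) r) ∧ (∀ z ∈ Metric.ball (ι x₀) r, ‖Φ t z‖ ≤ K) ∧ (∀ z ∈ Metric.ball (ι x₀) r, Φ t z = 0 → c ≤ ‖∑ i : Fin 3, (fderiv ℂ (Φ t) z (EuclideanSpace.single i (1:ℂ))) ^ 2‖) ∧ (∀ z ∈ D, Φ t z ≠ 0) ∧ (∃ x y : EuclideanSpace ℝ (Fin 3), dist x x₀ < r / 2 ∧ ‖y‖ = h t ∧ ι x + Complex.I • ι y ∈ Metric.ball (ι x₀) r ∧ Φ t (ι x + Complex.I •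 ι y) = 0) ∧ DifferentiableOn ℂ (F t) D ∧ (∀ x : EuclideanSpace ℝ (Fin 3), dist x x₀ < r → F t (ι x) = ι (u t x)) ∧ (∀ x y : EuclideanSpace ℝ (Fin 3), ι x + Complex.I • ι y ∈ D → (‖Φ t (ι x + Complex.I • ι y)‖ < c ∨ ‖Φ t (ι x - Complex.I • ι y)‖ < c) → ‖F t (ι x + Complex.I • ι y)‖ ≤ K * m t * (‖Φ t (ι x + Complex.I • ι y)‖ ^ (-α) + ‖Φ t (ι x - Complex.I • ι y)‖ ^ (-α)) + B) ∧ (∀ z ∈ D, ‖Φ t z‖ < c * h t → c * m t * ‖Φ t z‖ ^ (-α) - B ≤ ‖F t z‖)) →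
      (∀ r' > (0:ℝ), ∀ M : ℝ, ∃ t ∈ Set.Ico (0:ℝ) T, T - r' < t ∧ ∃ x : EuclideanSpace ℝ (Fin 3), dist x x₀ < r' ∧ M < ‖u t x‖) := by
  sorry

/-- **stub 2 — `stub_localLerayRate` (L/XL; local blow-up rate, OPEN without Type I).** At an
`L∞`-singular point `x₀` of a classical solution on `[0,T)`, Leray–Hopf from a rapidly decaying
datum, the local supremum obeys Leray's rate: for every `r' > 0` there are `c₁ > 0`, `t₁ ∈ [0,T)`
such that for every `t ∈ [t₁,T)` some `x ∈ B(x₀,r')` has `c₁/(T-t) ≤ |u(t,x)|²`. -/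
theorem stub_localLerayRate :
    ∀ (ν T : ℝ) (u : ℝ → EuclideanSpace ℝ (Fin 3) → EuclideanSpace ℝ (Fin 3)) (p : ℝ → EuclideanSpace ℝ (Fin 3) → ℝ), 0 < ν → 0 < T →
      Literature.Analysis.FluidPDE.IsClassicalNSSolutionOn (Set.Ico 0 T) ν 0 u p →
      Literature.Analysis.FluidPDE.IsLerayHopfOn T ν 0 (u 0) u →
      Literature.Analysis.FluidPDE.HasRapidSpatialDecay (u 0) →
      ∀ x₀ : EuclideanSpace ℝ (Fin 3),
      (∀ r' > (0:ℝ), ∀ M : ℝ, ∃ t ∈ Set.Ico (0:ℝ) T, T - r' < t ∧ ∃ x : EuclideanSpace ℝ (Fin 3), dist x x₀ < r' ∧ M < ‖u t x‖) →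
      ∀ r' > (0:ℝ), ∃ (c₁ t₁ : ℝ), 0 < c₁ ∧ 0 ≤ t₁ ∧ t₁ < T ∧
        ∀ t ∈ Set.Ico t₁ T, ∃ x : EuclideanSpace ℝ (Fin 3), dist x x₀ < r' ∧ c₁ / (T - t) ≤ ‖u t x‖ ^ 2 := by
  sorry

/-- **stub 3 — `stub_sheetCarriesLocalMax` (XL, OPEN; first complex→real transfer).** Under SHEET
data at `x₀`, the real trace near `x₀` is dominated by the pole pair for `t` close to `T`:
`|u(t,x)|² ≤ C · m(t)² h(t)^{-2α} + B'` on `B(x₀,r₂) × [t₂,T)`. -/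
theorem stub_sheetCarriesLocalMax :
    ∀ (ι : EuclideanSpace ℝ (Fin 3) → EuclideanSpace ℂ (Fin 3)),
      (∀ x : EuclideanSpace ℝ (Fin 3), ι x = Literature.Analysis.FunctionSpaces.EuclideanSpace.complexify x) →
      ∀ (ν T : ℝ) (u : ℝ → EuclideanSpace ℝ (Fin 3) → EuclideanSpace ℝ (Fin 3)) (p : ℝ → EuclideanSpace ℝ (Fin 3) → ℝ), 0 < ν → 0 < T →
      Literature.Analysis.FluidPDE.IsClassicalNSSolutionOn (Set.Ico 0 T) ν 0 u p →
      Literature.Analysis.FluidPDE.IsLerayHopfOn T ν 0 (u 0) u →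
      Literature.Analysis.FluidPDE.HasRapidSpatialDecay (u 0) →
      ∀ x₀ : EuclideanSpace ℝ (Fin 3),
      ∀ (r c K α τ B : ℝ) (Φ : ℝ → EuclideanSpace ℂ (Fin 3) → ℂ) (h m : ℝ → ℝ) (F : ℝ → EuclideanSpace ℂ (Fin 3) → EuclideanSpace ℂ (Fin 3)),
      (0 < r ∧ 0 < c ∧ 2 ≤ α ∧ 0 < τ ∧ τ ≤ T ∧ Filter.Tendsto h (nhdsWithin T (Set.Iio T)) (nhds 0) ∧ ∀ t ∈ Set.Ico (T - τ) T, ∀ (D : Set (EuclideanSpace ℂ (Fin 3))), D = (Metric.ball (ι x₀) r ∩ {z : EuclideanSpace ℂ (Fin 3) | ∃ x y : EuclideanSpace ℝ (Fin 3), dist x x₀ < r ∧ ‖y‖ < h t ∧ z = ι x + Complex.I • ι y}) → 0 < h t ∧ 0 < m t ∧ DifferentiableOn ℂ (Φ t) (Metric.ball (ι x₀) r) ∧ (∀ z ∈ Metric.ball (ι x₀) r, ‖Φ t z‖ ≤ K) ∧ (∀ z ∈ Metric.ball (ι x₀) r, Φ t z = 0 → c ≤ ‖∑ i : Fin 3,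 (fderiv ℂ (Φ t) z (EuclideanSpace.single i (1:ℂ))) ^ 2‖) ∧ (∀ z ∈ D, Φ t z ≠ 0) ∧ (∃ x y : EuclideanSpace ℝ (Fin 3), dist x x₀ < r / 2 ∧ ‖y‖ = h t ∧ ι x + Complex.I • ι y ∈ Metric.ball (ι x₀) r ∧ Φ t (ι x + Complex.I • ι y) = 0) ∧ DifferentiableOn ℂ (F t) D ∧ (∀ x : EuclideanSpace ℝ (Fin 3), dist x x₀ < r → F t (ι x) = ι (u t x)) ∧ (∀ x y : EuclideanSpace ℝ (Fin 3), ι x + Complex.I • ι y ∈ D → (‖Φ t (ι x + Complex.I • ι y)‖ < c ∨ ‖Φ t (ι x - Complex.I • ι y)‖ < c) → ‖F t (ι x + Complex.I • ι y)‖ ≤ K * m t * (‖Φ t (ι x + Complex.I • ι y)‖ ^ (-α) + ‖Φ t (ι x - Complex.I • ι y)‖ ^ (-α)) + B) ∧ (∀ z ∈ D, ‖Φ t z‖ < c * h t → c * m t * ‖Φ t z‖ ^ (-α) - B ≤ ‖F t z‖)) →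
      ∃ (C B' r₂ t₂ : ℝ), 0 < C ∧ 0 < r₂ ∧ 0 ≤ t₂ ∧ t₂ < T ∧
        ∀ t ∈ Set.Ico t₂ T, ∀ x : EuclideanSpace ℝ (Fin 3), dist x x₀ < r₂ →
          ‖u t x‖ ^ 2 ≤ C * (m t ^ 2 * h t ^ (-(2 * α))) + B' := by
  sorry

/-- **stub 4 — `stub_footprintDissipation` (XL, OPEN; second complex→real transfer, the route's
footprint dissipation law).** Under SHEET data at `x₀`, the local dissipation on `B(x₀,r)` dominates
the squared pole amplitude for `t` close to `T`:
`ofReal (c₂ · m(t)² h(t)^{-2α}) ≤ ∫⁻_{B(x₀,r)} |∇u(t)|² + ofReal B₂` (Frobenius norm of the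
classical gradient, as in the Leray–Hopf energy inequality). -/
theorem stub_footprintDissipation :
    ∀ (ι : EuclideanSpace ℝ (Fin 3) → EuclideanSpace ℂ (Fin 3)),
      (∀ x : EuclideanSpace ℝ (Fin 3), ι x = Literature.Analysis.FunctionSpaces.EuclideanSpace.complexify x) →
      ∀ (ν T : ℝ) (u : ℝ → EuclideanSpace ℝ (Fin 3) → EuclideanSpace ℝ (Fin 3)) (p : ℝ → EuclideanSpace ℝ (Fin 3) → ℝ), 0 < ν → 0 < T →
      Literature.Analysis.FluidPDE.IsClassicalNSSolutionOn (Set.Ico 0 T) ν 0 u p →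
      Literature.Analysis.FluidPDE.IsLerayHopfOn T ν 0 (u 0) u →
      Literature.Analysis.FluidPDE.HasRapidSpatialDecay (u 0) →
      ∀ x₀ : EuclideanSpace ℝ (Fin 3),
      ∀ (r c K α τ B : ℝ) (Φ : ℝ → EuclideanSpace ℂ (Fin 3) → ℂ) (h m : ℝ → ℝ) (F : ℝ → EuclideanSpace ℂ (Fin 3) → EuclideanSpace ℂ (Fin 3)),
      (0 < r ∧ 0 < c ∧ 2 ≤ α ∧ 0 < τ ∧ τ ≤ T ∧ Filter.Tendsto h (nhdsWithin T (Set.Iio T)) (nhds 0) ∧ ∀ t ∈ Set.Ico (T - τ) T, ∀ (D : Set (EuclideanSpace ℂ (Fin 3))), D = (Metric.ball (ι x₀) r ∩ {z : EuclideanSpace ℂ (Fin 3) | ∃ x y : EuclideanSpace ℝ (Fin 3), dist x x₀ < r ∧ ‖y‖ < h t ∧ z = ι x + Complex.I • ι y}) → 0 < h t ∧ 0 < m t ∧ DifferentiableOn ℂ (Φ t) (Metric.ball (ι x₀) r) ∧ (∀ z ∈ Metric.ball (ι x₀) r, ‖Φ t z‖ ≤ K) ∧ (∀ z ∈ Metric.ball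 (ι x₀) r, Φ t z = 0 → c ≤ ‖∑ i : Fin 3, (fderiv ℂ (Φ t) z (EuclideanSpace.single i (1:ℂ))) ^ 2‖) ∧ (∀ z ∈ D, Φ t z ≠ 0) ∧ (∃ x y : EuclideanSpace ℝ (Fin 3), dist x x₀ < r / 2 ∧ ‖y‖ = h t ∧ ι x + Complex.I • ι y ∈ Metric.ball (ι x₀) r ∧ Φ t (ι x + Complex.I • ι y) = 0) ∧ DifferentiableOn ℂ (F t) D ∧ (∀ x : EuclideanSpace ℝ (Fin 3), dist x x₀ < r → F t (ι x) = ι (u t x)) ∧ (∀ x y : EuclideanSpace ℝ (Fin 3), ι x + Complex.I • ι y ∈ D → (‖Φ t (ι x + Complex.I • ι y)‖ < c ∨ ‖Φ t (ι x - Complex.I • ι y)‖ < c) → ‖F t (ι x + Complex.I • ι y)‖ ≤ K * m t * (‖Φ t (ι x + Complex.I • ι y)‖ ^ (-α) + ‖Φ t (ι x - Complex.I • ι y)‖ ^ (-α)) + B) ∧ (∀ z ∈ D, ‖Φ t z‖ < c * h t → c * m t * ‖Φ t z‖ ^ (-α) - B ≤ ‖F t z‖)) →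
      ∃ (c₂ B₂ t₂ : ℝ), 0 < c₂ ∧ 0 ≤ t₂ ∧ t₂ < T ∧
        ∀ t ∈ Set.Ico t₂ T,
          ENNReal.ofReal (c₂ * (m t ^ 2 * h t ^ (-(2 * α)))) ≤
            (∫⁻ x in Metric.ball x₀ r, ENNReal.ofReal (Literature.Analysis.FluidPDE.frobeniusNormSq (fderiv ℝ (u t) x))) + ENNReal.ofReal B₂ := by
  sorry

/-- **stub 5 — `stub_energyBudget` (M; Leray–Hopf energy inequality with the classical gradient).**
For a classical solution on `[0,T)` which is Leray–Hopf on `[0,T)` from `u 0`, the space-time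
dissipation `∫₀ᵀ ∫ |∇u|²` of the CLASSICAL gradient is finite. -/
theorem stub_energyBudget :
    ∀ (ν T : ℝ) (u : ℝ → EuclideanSpace ℝ (Fin 3) → EuclideanSpace ℝ (Fin 3)) (p : ℝ → EuclideanSpace ℝ (Fin 3) → ℝ), 0 < ν → 0 < T →
      Literature.Analysis.FluidPDE.IsClassicalNSSolutionOn (Set.Ico 0 T) ν 0 u p →
      Literature.Analysis.FluidPDE.IsLerayHopfOn T ν 0 (u 0) u →
      ∫⁻ t in Set.Ioo 0 T, ∫⁻ x, ENNReal.ofReal (Literature.Analysis.FluidPDE.frobeniusNormSq (fderiv ℝ (u t) x)) < ⊤ := by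
  sorry

/-! ### Glue lemmas (sorry-free) -/

/-- **Harmonic divergence.** `∫_{(t₀,T)} a/(T-t) dt = ∞` for `a > 0`, `t₀ < T` (as a lower Lebesgue
integral of `ofReal`). From Mathlib's `intervalIntegrable_sub_inv_iff`. -/
theorem lintegral_ofReal_div_sub_eq_top {a t₀ T : ℝ} (ha : 0 < a) (ht₀ : t₀ < T) :
    ∫⁻ t in Set.Ioo t₀ T, ENNReal.ofReal (a / (T - t)) = ∞ := by
  by_contra hne
  have hmeas : Measurable fun t : ℝ => a / (T - t) :=
    measurable_const.div (measurable_const.sub measurable_id)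
  have hnn : 0 ≤ᵐ[volume.restrict (Set.Ioo t₀ T)] fun t : ℝ => a / (T - t) := by
    filter_upwards [ae_restrict_mem measurableSet_Ioo] with t ht
    exact div_nonneg ha.le (sub_nonneg.2 ht.2.le)
  have hint : IntegrableOn (fun t : ℝ => a / (T - t)) (Set.Ioo t₀ T) := by
    refine ⟨hmeas.aestronglyMeasurable, ?_⟩
    rw [hasFiniteIntegral_iff_ofReal hnn]
    exact lt_top_iff_ne_top.2 hne
  have hint' : IntegrableOn (fun t : ℝ => (t - T)⁻¹) (Set.Ioo t₀ T) := by
    have h2 : IntegrableOn (fun t : ℝ => -(a⁻¹) * (a / (T - t))) (Set.Ioo t₀ T) :=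
      hint.const_mul (-(a⁻¹))
    refine h2.congr_fun (fun t _ => ?_) measurableSet_Ioo
    have ha' : a ≠ 0 := ha.ne'
    show -a⁻¹ * (a / (T - t)) = (t - T)⁻¹
    rw [div_eq_mul_inv, ← mul_assoc, neg_mul, inv_mul_cancel₀ ha', neg_one_mul, ← inv_neg, neg_sub]
  have hII : IntervalIntegrable (fun t : ℝ => (t - T)⁻¹) volume t₀ T := by
    rw [intervalIntegrable_iff_integrableOn_Ioo_of_le ht₀.le]
    exact hint'
  rcases intervalIntegrable_sub_inv_iff.1 hII with h | h
  · exact absurd h ht₀.ne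
  · exact h Set.right_mem_uIcc

/-! ### Composition -/

/-- **Birth composition, CLOSED form.** The five stub STATEMENTS imply the crux (its body verbatim; the by-name
form is `NoSheetTouchdown_of` below, which the skeleton registry reads). Real glue:
stub 1 makes `x₀` singular; stubs 2 + 3 turn the local Leray rate into a rate for the pole amplitude,
`a/(T-t) ≤ c₂ m²h^{-2α} + c₂B'/C`; stub 4 bounds that by the local dissipation; integrating on
`(t₃,T)` gives `∞ ≤` (stub 5's energy budget `+` a constant `×` the length) `< ∞`. -/
theorem NoSheetTouchdown_of_hyps
    (h1 : ∀ (ι : EuclideanSpace ℝ (Fin 3) → EuclideanSpace ℂ (Fin 3)),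
      (∀ x : EuclideanSpace ℝ (Fin 3), ι x = Literature.Analysis.FunctionSpaces.EuclideanSpace.complexify x) →
      ∀ (ν T : ℝ) (u : ℝ → EuclideanSpace ℝ (Fin 3) → EuclideanSpace ℝ (Fin 3)) (p : ℝ → EuclideanSpace ℝ (Fin 3) → ℝ), 0 < ν → 0 < T →
      Literature.Analysis.FluidPDE.IsClassicalNSSolutionOn (Set.Ico 0 T) ν 0 u p →
      Literature.Analysis.FluidPDE.IsLerayHopfOn T ν 0 (u 0) u →
      Literature.Analysis.FluidPDE.HasRapidSpatialDecay (u 0) →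
      ∀ x₀ : EuclideanSpace ℝ (Fin 3),
      ∀ (r c K α τ B : ℝ) (Φ : ℝ → EuclideanSpace ℂ (Fin 3) → ℂ) (h m : ℝ → ℝ) (F : ℝ → EuclideanSpace ℂ (Fin 3) → EuclideanSpace ℂ (Fin 3)),
      (0 < r ∧ 0 < c ∧ 2 ≤ α ∧ 0 < τ ∧ τ ≤ T ∧ Filter.Tendsto h (nhdsWithin T (Set.Iio T)) (nhds 0) ∧ ∀ t ∈ Set.Ico (T - τ) T, ∀ (D : Set (EuclideanSpace ℂ (Fin 3))), D = (Metric.ball (ι x₀) r ∩ {z : EuclideanSpace ℂ (Fin 3) | ∃ x y : EuclideanSpace ℝ (Fin 3), dist x x₀ < r ∧ ‖y‖ < h t ∧ z = ι x + Complex.I • ι y}) → 0 < h t ∧ 0 < m t ∧ DifferentiableOn ℂ (Φ t) (Metric.ball (ι x₀) r) ∧ (∀ z ∈ Metric.ball (ι x₀) r, ‖Φ t z‖ ≤ K) ∧ (∀ z ∈ Metric.ball (ι x₀) r, Φ t z = 0 → c ≤ ‖∑ i : Fin 3, (fderiv ℂ (Φ t) z (EuclideanSpace.single i (1:ℂ)))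 ^ 2‖) ∧ (∀ z ∈ D, Φ t z ≠ 0) ∧ (∃ x y : EuclideanSpace ℝ (Fin 3), dist x x₀ < r / 2 ∧ ‖y‖ = h t ∧ ι x + Complex.I • ι y ∈ Metric.ball (ι x₀) r ∧ Φ t (ι x + Complex.I • ι y) = 0) ∧ DifferentiableOn ℂ (F t) D ∧ (∀ x : EuclideanSpace ℝ (Fin 3), dist x x₀ < r → F t (ι x) = ι (u t x)) ∧ (∀ x y : EuclideanSpace ℝ (Fin 3), ι x + Complex.I • ι y ∈ D → (‖Φ t (ι x + Complex.I • ι y)‖ < c ∨ ‖Φ t (ι x - Complex.I • ι y)‖ < c) → ‖F t (ι x + Complex.I • ι y)‖ ≤ K * m t * (‖Φ t (ι x + Complex.I • ι y)‖ ^ (-α) + ‖Φ t (ι x - Complex.I • ι y)‖ ^ (-α)) + B) ∧ (∀ z ∈ D, ‖Φ t z‖ < c * h t → c * m t * ‖Φ t z‖ ^ (-α) - B ≤ ‖F t z‖)) →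
      (∀ r' > (0:ℝ), ∀ M : ℝ, ∃ t ∈ Set.Ico (0:ℝ) T, T - r' < t ∧ ∃ x : EuclideanSpace ℝ (Fin 3), dist x x₀ < r' ∧ M < ‖u t x‖))
    (h2 : ∀ (ν T : ℝ) (u : ℝ → EuclideanSpace ℝ (Fin 3) → EuclideanSpace ℝ (Fin 3)) (p : ℝ → EuclideanSpace ℝ (Fin 3) → ℝ), 0 < ν → 0 < T →
      Literature.Analysis.FluidPDE.IsClassicalNSSolutionOn (Set.Ico 0 T) ν 0 u p →
      Literature.Analysis.FluidPDE.IsLerayHopfOn T ν 0 (u 0) u →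
      Literature.Analysis.FluidPDE.HasRapidSpatialDecay (u 0) →
      ∀ x₀ : EuclideanSpace ℝ (Fin 3),
      (∀ r' > (0:ℝ), ∀ M : ℝ, ∃ t ∈ Set.Ico (0:ℝ) T, T - r' < t ∧ ∃ x : EuclideanSpace ℝ (Fin 3), dist x x₀ < r' ∧ M < ‖u t x‖) →
      ∀ r' > (0:ℝ), ∃ (c₁ t₁ : ℝ), 0 < c₁ ∧ 0 ≤ t₁ ∧ t₁ < T ∧
        ∀ t ∈ Set.Ico t₁ T, ∃ x : EuclideanSpace ℝ (Fin 3), dist x x₀ < r' ∧ c₁ / (T - t) ≤ ‖u t x‖ ^ 2)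
    (h3 : ∀ (ι : EuclideanSpace ℝ (Fin 3) → EuclideanSpace ℂ (Fin 3)),
      (∀ x : EuclideanSpace ℝ (Fin 3), ι x = Literature.Analysis.FunctionSpaces.EuclideanSpace.complexify x) →
      ∀ (ν T : ℝ) (u : ℝ → EuclideanSpace ℝ (Fin 3) → EuclideanSpace ℝ (Fin 3)) (p : ℝ → EuclideanSpace ℝ (Fin 3) → ℝ), 0 < ν → 0 < T →
      Literature.Analysis.FluidPDE.IsClassicalNSSolutionOn (Set.Ico 0 T) ν 0 u p →
      Literature.Analysis.FluidPDE.IsLerayHopfOn T ν 0 (u 0) u →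
      Literature.Analysis.FluidPDE.HasRapidSpatialDecay (u 0) →
      ∀ x₀ : EuclideanSpace ℝ (Fin 3),
      ∀ (r c K α τ B : ℝ) (Φ : ℝ → EuclideanSpace ℂ (Fin 3) → ℂ) (h m : ℝ → ℝ) (F : ℝ → EuclideanSpace ℂ (Fin 3) → EuclideanSpace ℂ (Fin 3)),
      (0 < r ∧ 0 < c ∧ 2 ≤ α ∧ 0 < τ ∧ τ ≤ T ∧ Filter.Tendsto h (nhdsWithin T (Set.Iio T)) (nhds 0) ∧ ∀ t ∈ Set.Ico (T - τ) T, ∀ (D : Set (EuclideanSpace ℂ (Fin 3))), D = (Metric.ball (ι x₀) r ∩ {z : EuclideanSpace ℂ (Fin 3) | ∃ x y : EuclideanSpace ℝ (Fin 3), dist x x₀ < r ∧ ‖y‖ < h t ∧ z = ι x + Complex.I • ι y}) → 0 < h t ∧ 0 < m t ∧ DifferentiableOn ℂ (Φ t) (Metric.ball (ι x₀) r) ∧ (∀ z ∈ Metric.ball (ι x₀) r, ‖Φ t z‖ ≤ K) ∧ (∀ z ∈ Metric.ball (ι x₀) r, Φ t z = 0 → c ≤ ‖∑ i : Fin 3,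 (fderiv ℂ (Φ t) z (EuclideanSpace.single i (1:ℂ))) ^ 2‖) ∧ (∀ z ∈ D, Φ t z ≠ 0) ∧ (∃ x y : EuclideanSpace ℝ (Fin 3), dist x x₀ < r / 2 ∧ ‖y‖ = h t ∧ ι x + Complex.I • ι y ∈ Metric.ball (ι x₀) r ∧ Φ t (ι x + Complex.I • ι y) = 0) ∧ DifferentiableOn ℂ (F t) D ∧ (∀ x : EuclideanSpace ℝ (Fin 3), dist x x₀ < r → F t (ι x) = ι (u t x)) ∧ (∀ x y : EuclideanSpace ℝ (Fin 3), ι x + Complex.I • ι y ∈ D → (‖Φ t (ι x + Complex.I • ι y)‖ < c ∨ ‖Φ t (ι x - Complex.I • ι y)‖ < c) → ‖F t (ι x + Complex.I • ι y)‖ ≤ K * m t * (‖Φ t (ι x + Complex.I • ι y)‖ ^ (-α) + ‖Φ t (ι x - Complex.I • ι y)‖ ^ (-α)) + B) ∧ (∀ z ∈ D, ‖Φ t z‖ < c * h t → c * m t * ‖Φ t z‖ ^ (-α) - B ≤ ‖F t z‖)) →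
      ∃ (C B' r₂ t₂ : ℝ), 0 < C ∧ 0 < r₂ ∧ 0 ≤ t₂ ∧ t₂ < T ∧
        ∀ t ∈ Set.Ico t₂ T, ∀ x : EuclideanSpace ℝ (Fin 3), dist x x₀ < r₂ →
          ‖u t x‖ ^ 2 ≤ C * (m t ^ 2 * h t ^ (-(2 * α))) + B')
    (h4 : ∀ (ι : EuclideanSpace ℝ (Fin 3) → EuclideanSpace ℂ (Fin 3)),
      (∀ x : EuclideanSpace ℝ (Fin 3), ι x = Literature.Analysis.FunctionSpaces.EuclideanSpace.complexify x) →
      ∀ (ν T : ℝ) (u : ℝ → EuclideanSpace ℝ (Fin 3) → EuclideanSpace ℝ (Fin 3)) (p : ℝ → EuclideanSpace ℝ (Fin 3) → ℝ), 0 < ν → 0 < T →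
      Literature.Analysis.FluidPDE.IsClassicalNSSolutionOn (Set.Ico 0 T) ν 0 u p →
      Literature.Analysis.FluidPDE.IsLerayHopfOn T ν 0 (u 0) u →
      Literature.Analysis.FluidPDE.HasRapidSpatialDecay (u 0) →
      ∀ x₀ : EuclideanSpace ℝ (Fin 3),
      ∀ (r c K α τ B : ℝ) (Φ : ℝ → EuclideanSpace ℂ (Fin 3) → ℂ) (h m : ℝ → ℝ) (F : ℝ → EuclideanSpace ℂ (Fin 3) → EuclideanSpace ℂ (Fin 3)),
      (0 < r ∧ 0 < c ∧ 2 ≤ α ∧ 0 < τ ∧ τ ≤ T ∧ Filter.Tendsto h (nhdsWithin T (Set.Iio T)) (nhds 0) ∧ ∀ t ∈ Set.Ico (T - τ) T, ∀ (D : Set (EuclideanSpace ℂ (Fin 3))), D = (Metric.ball (ι x₀) r ∩ {z : EuclideanSpace ℂ (Fin 3) | ∃ x y : EuclideanSpace ℝ (Fin 3), dist x x₀ < r ∧ ‖y‖ < h t ∧ z = ι x + Complex.I • ι y}) → 0 < h t ∧ 0 < m t ∧ DifferentiableOn ℂ (Φ t) (Metric.ball (ι x₀) r) ∧ (∀ z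 ∈ Metric.ball (ι x₀) r, ‖Φ t z‖ ≤ K) ∧ (∀ z ∈ Metric.ball (ι x₀) r, Φ t z = 0 → c ≤ ‖∑ i : Fin 3, (fderiv ℂ (Φ t) z (EuclideanSpace.single i (1:ℂ))) ^ 2‖) ∧ (∀ z ∈ D, Φ t z ≠ 0) ∧ (∃ x y : EuclideanSpace ℝ (Fin 3), dist x x₀ < r / 2 ∧ ‖y‖ = h t ∧ ι x + Complex.I • ι y ∈ Metric.ball (ι x₀) r ∧ Φ t (ι x + Complex.I • ι y) = 0) ∧ DifferentiableOn ℂ (F t) D ∧ (∀ x : EuclideanSpace ℝ (Fin 3), dist x x₀ < r → F t (ι x) = ι (u t x)) ∧ (∀ x y : EuclideanSpace ℝ (Fin 3), ι x + Complex.I • ι y ∈ D → (‖Φ t (ι x + Complex.I • ι y)‖ < c ∨ ‖Φ t (ι x - Complex.I • ι y)‖ < c) → ‖F t (ι x + Complex.I • ι y)‖ ≤ K * m t * (‖Φ t (ι x + Complex.I • ι y)‖ ^ (-α) + ‖Φ t (ι x - Complex.I • ι y)‖ ^ (-α)) + B) ∧ (∀ z ∈ D, ‖Φ t z‖ < c *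 h t → c * m t * ‖Φ t z‖ ^ (-α) - B ≤ ‖F t z‖)) →
      ∃ (c₂ B₂ t₂ : ℝ), 0 < c₂ ∧ 0 ≤ t₂ ∧ t₂ < T ∧
        ∀ t ∈ Set.Ico t₂ T,
          ENNReal.ofReal (c₂ * (m t ^ 2 * h t ^ (-(2 * α)))) ≤
            (∫⁻ x in Metric.ball x₀ r, ENNReal.ofReal (Literature.Analysis.FluidPDE.frobeniusNormSq (fderiv ℝ (u t) x))) + ENNReal.ofReal B₂)
    (h5 : ∀ (ν T : ℝ) (u : ℝ → EuclideanSpace ℝ (Fin 3) → EuclideanSpace ℝ (Fin 3)) (p : ℝ → EuclideanSpace ℝ (Fin 3) → ℝ), 0 < ν → 0 < T →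
      Literature.Analysis.FluidPDE.IsClassicalNSSolutionOn (Set.Ico 0 T) ν 0 u p →
      Literature.Analysis.FluidPDE.IsLerayHopfOn T ν 0 (u 0) u →
      ∫⁻ t in Set.Ioo 0 T, ∫⁻ x, ENNReal.ofReal (Literature.Analysis.FluidPDE.frobeniusNormSq (fderiv ℝ (u t) x)) < ⊤) :
    ∀ (ι : EuclideanSpace ℝ (Fin 3) → EuclideanSpace ℂ (Fin 3)),
      (∀ x : EuclideanSpace ℝ (Fin 3), ι x = Literature.Analysis.FunctionSpaces.EuclideanSpace.complexify x) →
      ∀ (ν T : ℝ) (u : ℝ → EuclideanSpace ℝ (Fin 3) → EuclideanSpace ℝ (Fin 3)) (p : ℝ → EuclideanSpace ℝ (Fin 3) → ℝ), 0 < ν → 0 < T →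
      Literature.Analysis.FluidPDE.IsClassicalNSSolutionOn (Set.Ico 0 T) ν 0 u p →
      Literature.Analysis.FluidPDE.IsLerayHopfOn T ν 0 (u 0) u →
      Literature.Analysis.FluidPDE.HasRapidSpatialDecay (u 0) →
      ∀ x₀ : EuclideanSpace ℝ (Fin 3),
      ¬ (∃ (r c K α τ B : ℝ) (Φ : ℝ → EuclideanSpace ℂ (Fin 3) → ℂ) (h m : ℝ → ℝ) (F : ℝ → EuclideanSpace ℂ (Fin 3) → EuclideanSpace ℂ (Fin 3)),
        (0 < r ∧ 0 < c ∧ 2 ≤ α ∧ 0 < τ ∧ τ ≤ T ∧ Filter.Tendsto h (nhdsWithin T (Set.Iio T)) (nhds 0) ∧ ∀ t ∈ Set.Ico (T - τ) T, ∀ (D : Set (EuclideanSpace ℂ (Fin 3))), D = (Metric.ball (ι x₀) r ∩ {z : EuclideanSpace ℂ (Fin 3) | ∃ x y : EuclideanSpace ℝ (Fin 3), dist x x₀ < r ∧ ‖y‖ < h t ∧ z = ι x + Complex.I • ι y}) → 0 < h t ∧ 0 < m t ∧ DifferentiableOn ℂ (Φ t) (Metric.ball (ι x₀) r) ∧ (∀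 z ∈ Metric.ball (ι x₀) r, ‖Φ t z‖ ≤ K) ∧ (∀ z ∈ Metric.ball (ι x₀) r, Φ t z = 0 → c ≤ ‖∑ i : Fin 3, (fderiv ℂ (Φ t) z (EuclideanSpace.single i (1:ℂ))) ^ 2‖) ∧ (∀ z ∈ D, Φ t z ≠ 0) ∧ (∃ x y : EuclideanSpace ℝ (Fin 3), dist x x₀ < r / 2 ∧ ‖y‖ = h t ∧ ι x + Complex.I • ι y ∈ Metric.ball (ι x₀) r ∧ Φ t (ι x + Complex.I • ι y) = 0) ∧ DifferentiableOn ℂ (F t) D ∧ (∀ x : EuclideanSpace ℝ (Fin 3), dist x x₀ < r → F t (ι x) = ι (u t x)) ∧ (∀ x y : EuclideanSpace ℝ (Fin 3), ι x + Complex.I • ι y ∈ D → (‖Φ t (ι x + Complex.I • ι y)‖ < c ∨ ‖Φ t (ι x - Complex.I • ι y)‖ < c) → ‖F t (ι x + Complex.I • ι y)‖ ≤ K * m t * (‖Φ t (ι x + Complex.I • ι y)‖ ^ (-α) + ‖Φ t (ι x - Complex.I • ι y)‖ ^ (-α)) + B) ∧ (∀ z ∈ D, ‖Φ t z‖ < c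 * h t → c * m t * ‖Φ t z‖ ^ (-α) - B ≤ ‖F t z‖))) := by
  intro ι hι ν T u p hν hT hcl hLH hdec x₀
  rintro ⟨r, c, K, α, τ, B, Φ, h, m, F, hsheet⟩
  -- stub 1: x₀ is an L∞-singular point
  have hTD := h1 ι hι ν T u p hν hT hcl hLH hdec x₀ r c K α τ B Φ h m F hsheet
  -- stub 3: the sheet carries the local maximum
  obtain ⟨C, B', r₂, t₂, hC, hr₂, ht₂, ht₂T, hloc⟩ :=
    h3 ι hι ν T u p hν hT hcl hLH hdec x₀ r c K α τ B Φ h m F hsheet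
  -- stub 2: local Leray rate on B(x₀, r₂)
  obtain ⟨c₁, t₁, hc₁, ht₁, ht₁T, hrate⟩ := h2 ν T u p hν hT hcl hLH hdec x₀ hTD r₂ hr₂
  -- stub 4: footprint dissipation
  obtain ⟨c₂, B₂, t₄, hc₂, ht₄, ht₄T, hdis⟩ :=
    h4 ι hι ν T u p hν hT hcl hLH hdec x₀ r c K α τ B Φ h m F hsheet
  -- stub 5: energy budget
  have hbudget := h5 ν T u p hν hT hcl hLH
  -- the common time window [t₃, T)
  set t₃ : ℝ := max (max t₁ t₂) t₄ with ht₃def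
  have ht₃1 : t₁ ≤ t₃ := (le_max_left _ _).trans (le_max_left _ _)
  have ht₃2 : t₂ ≤ t₃ := (le_max_right _ _).trans (le_max_left _ _)
  have ht₃4 : t₄ ≤ t₃ := le_max_right _ _
  have ht₃0 : 0 ≤ t₃ := ht₁.trans ht₃1
  have ht₃T : t₃ < T := max_lt (max_lt ht₁T ht₂T) ht₄T
  -- notation
  set a : ℝ := c₂ * c₁ / C with hadef
  have ha : 0 < a := div_pos (mul_pos hc₂ hc₁) hC
  set Kc : ℝ≥0∞ := ENNReal.ofReal B₂ + ENNReal.ofReal (c₂ * B' / C) with hKcdef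
  set Dfun : ℝ → ℝ≥0∞ := fun t =>
    ∫⁻ x in Metric.ball x₀ r, ENNReal.ofReal (Literature.Analysis.FluidPDE.frobeniusNormSq (fderiv ℝ (u t) x))
    with hDdef
  -- pointwise in time: ofReal (a/(T-t)) ≤ D(t) + Kc on (t₃, T)
  have hpt : ∀ t ∈ Set.Ioo t₃ T, ENNReal.ofReal (a / (T - t)) ≤ Dfun t + Kc := by
    intro t ht
    have ht1 : t ∈ Set.Ico t₁ T := ⟨ht₃1.trans ht.1.le, ht.2⟩
    have ht2 : t ∈ Set.Ico t₂ T := ⟨ht₃2.trans ht.1.le, ht.2⟩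
    have ht4 : t ∈ Set.Ico t₄ T := ⟨ht₃4.trans ht.1.le, ht.2⟩
    obtain ⟨x, hx, hrx⟩ := hrate t ht1
    have hlx := hloc t ht2 x hx
    have hdx := hdis t ht4
    set X : ℝ := m t ^ 2 * h t ^ (-(2 * α)) with hXdef
    -- real arithmetic: a/(T-t) ≤ c₂ X + c₂ B'/C
    have hreal : a / (T - t) ≤ c₂ * X + c₂ * B' / C := by
      have hchain : c₁ / (T - t) ≤ C * X + B' := hrx.trans hlx
      have hmul : c₂ / C * (c₁ / (T - t)) ≤ c₂ / C * (C * X + B') :=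
        mul_le_mul_of_nonneg_left hchain (div_nonneg hc₂.le hC.le)
      have hCne : C ≠ 0 := hC.ne'
      have hlhs : a / (T - t) = c₂ / C * (c₁ / (T - t)) := by
        rw [hadef]; ring
      have hrhs : c₂ / C * (C * X + B') = c₂ * X + c₂ * B' / C := by
        field_simp
      rw [hlhs, ← hrhs]
      exact hmul
    calc ENNReal.ofReal (a / (T - t))
        ≤ ENNReal.ofReal (c₂ * X + c₂ * B' / C) := ENNReal.ofReal_le_ofReal hreal
      _ ≤ ENNReal.ofReal (c₂ * X) + ENNReal.ofReal (c₂ * B' / C) := ENNReal.ofReal_add_le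
      _ ≤ (Dfun t + ENNReal.ofReal B₂) + ENNReal.ofReal (c₂ * B' / C) := by gcongr
      _ = Dfun t + Kc := by rw [hKcdef, add_assoc]
  -- integrate over (t₃, T)
  have hle : ∫⁻ t in Set.Ioo t₃ T, ENNReal.ofReal (a / (T - t)) ≤ ∫⁻ t in Set.Ioo t₃ T, (Dfun t + Kc) :=
    setLIntegral_mono' measurableSet_Ioo hpt
  have hsplit : ∫⁻ t in Set.Ioo t₃ T, (Dfun t + Kc) =
      (∫⁻ t in Set.Ioo t₃ T, Dfun t) + Kc * volume (Set.Ioo t₃ T) := by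
    rw [lintegral_add_right _ measurable_const, setLIntegral_const]
  -- the dissipation part is bounded by the energy budget
  have hD : (∫⁻ t in Set.Ioo t₃ T, Dfun t) ≤
      ∫⁻ t in Set.Ioo 0 T, ∫⁻ x, ENNReal.ofReal (Literature.Analysis.FluidPDE.frobeniusNormSq (fderiv ℝ (u t) x)) := by
    calc (∫⁻ t in Set.Ioo t₃ T, Dfun t)
        ≤ ∫⁻ t in Set.Ioo 0 T, Dfun t := lintegral_mono_set (Set.Ioo_subset_Ioo_left ht₃0)
      _ ≤ ∫⁻ t in Set.Ioo 0 T, ∫⁻ x, ENNReal.ofReal (Literature.Analysis.FluidPDE.frobeniusNormSq (fderiv ℝ (u t) x)) :=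
          lintegral_mono fun t => setLIntegral_le_lintegral _ _
  have hKc : Kc * volume (Set.Ioo t₃ T) < ∞ := by
    refine ENNReal.mul_lt_top ?_ measure_Ioo_lt_top
    rw [hKcdef]
    exact ENNReal.add_lt_top.2 ⟨ENNReal.ofReal_lt_top, ENNReal.ofReal_lt_top⟩
  have hfin : ∫⁻ t in Set.Ioo t₃ T, (Dfun t + Kc) < ∞ := by
    rw [hsplit]
    exact ENNReal.add_lt_top.2 ⟨lt_of_le_of_lt hD hbudget, hKc⟩
  have htop : ∫⁻ t in Set.Ioo t₃ T, ENNReal.ofReal (a / (T - t)) = ∞ :=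
    lintegral_ofReal_div_sub_eq_top ha ht₃T
  exact absurd (lt_of_le_of_lt hle hfin) (by rw [htop]; exact lt_irrefl _)

/-- **Birth composition (the skeleton theorem, A12 shape).** The crux BY NAME from the five registered
stubs, used by name; all glue is in the closed `NoSheetTouchdown_of_hyps`. -/
theorem NoSheetTouchdown_of : Theses.ComplexTouchdown.NoSheetTouchdown :=
  NoSheetTouchdown_of_hyps stub_sheetPointIsSingular stub_localLerayRate stub_sheetCarriesLocalMax
    stub_footprintDissipation stub_energyBudget

end Summit.NavierStokesRegularity.NavierStokesRegularity.Cruxes.NoSheetTouchdown.Birth
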